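import Mathlib
import HarnessLib
import Summits.Ventures.LatticeQCDFlow.Exactness.U1MetropolisLinkErgodic
import Summits.Ventures.LatticeQCDFlow.Exactness.DoeblinAutocovariance

/-!
# The N-hit Metropolis SWEEP over the links of a `U(1)` lattice is Doeblin (kick size `s`, `nhit = 2^j` with `(3/2)^j s ≥ π`)

HONEST FRAMING: exact (Metropolis-corrected) sampling algorithms for lattice gauge theory;
figures of merit are autocorrelation/cost numbers at stated couplings and volumes; no
continuum-physics claim.

Venture `LatticeQCDFlow` (cell pub-lqcd), topic `Exactness`, FANOUT row 9 (eng-latcore, the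
engine `latflow.core.u1_2d.U1Field2D.sweep_metropolis(β, step, nhit)`: a scan over all links, each
visited with `nhit` random-walk Metropolis hits `θ ← θ + step·U[−1,1]`, the others frozen).  NEW
WORK of the cell over the tree (`U1MetropolisLinkErgodic.lean`: a pinched weight makes every hit
dominate `(m/M) ×` its proposal, `2^j` kicks cover the circle; `RefreshScan.lean`: `siteLift`,
`refresh`, `cycle_minorised`, `cycle_refresh_eq_const`, `uniformlyErgodic_of_minorised`;
`InvariantComposition.lean`: `nHit`, `cycle`; `DoeblinUniqueness.lean`; `DoeblinAutocovariance.lean`: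
`isMarkovKernel_nHit`); nothing is cited as a fact.

THE SWEEP, TYPED ON THE FULL CONFIGURATION SPACE `ι → U(1)` (`ι` = the links, finite):
`u1LinkProposal s l` kicks link `l` by `e^{iθ}`, `θ` uniform on `|θ| < s` (a `siteLift` of the
one-link random walk); `u1LinkHit s w l = symMH (u1LinkProposal s l) w` is the Metropolis hit for the
JOINT weight `w = e^{−S}` (so ΔS is read off the touched plaquettes — nothing here needs that);
`u1MetropolisSweep s w n L = cycle (L.map (l ↦ (u1LinkHit s w l)^n))`.

* §1 `nHit_add`, `instIsMarkovKernelNHit`, `nHit_siteLift_eval` — `n` kicks of link `l` in a row are ONE site update by the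
  `n`-fold one-link walk (the environment is untouched); `haar_bind_mulWalk` — Haar is invariant
  under a kick.
* §2 `u1Kick_nHit_minorised` — `2^j` kicks of ONE link dominate `δ(s,j) ·` Haar from every start as
  soon as `(3/2)^j s ≥ π` (`UniformKickDoubling`, constants explicit), and then so do `n ≥ 2^j` kicks
  (`u1Kick_nHit_minorised_of_le`); `u1LinkVisit_minorised` — hence ONE VISIT (`n` hits, weight
  pinched `0 < m ≤ w ≤ M`) dominates `(m/M)^n δ ·` the FREE HAAR REFRESH of the link, uniformly in
  the configuration.
* §3 **`u1MetropolisSweep_minorised`** — a sweep visiting every link dominates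
  `((m/M)^n δ)^{|L|} · Haar^{⊗ι}` from EVERY configuration (Doeblin);
  **`u1MetropolisSweep_uniformlyErgodic`** — so it converges geometrically in total variation, from
  every initial law, to ANY probability law it leaves invariant, and
  **`u1MetropolisSweep_invariant_subsingleton`** — it has at most one invariant probability law.

For the engine: `w = e^{−βS_W}` is pinched on the compact configuration space, so at `step = s`
the theorem covers `nhit = 2^j ≥ N(s)` (`nhit = 4` needs `(9/4)s ≥ π`, i.e. `step ≥ 1.40`;
`step = 1.0` needs `nhit = 8`).  NOT here: that the Gibbs law `Z⁻¹e^{−βS_W}·Haar^{⊗ι}` IS invariant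
under each hit on the product space (the tree proves Metropolis-link reversibility in the `X × Y`
picture, `LocalMetropolis.linkMetropolis_isReversible`; the `Π`-picture transfer is not re-done
here, so the convergence statement names the invariant law abstractly); the default
`(step, nhit) = (1.0, 4)` (needs kicks of one link accumulated ACROSS sweeps — they commute on the
all-accept event — not assembled); `nhit` not a power of two (monotonicity in `n` is §2); `SU(2)`.
-/

noncomputable section

namespace Summit.Ventures.LatticeQCDFlow.Exactness

open MeasureTheory ProbabilityTheory ProbabilityTheory.Kernel Set Metric Function
open Literature.MathematicalPhysics.QuantumFieldTheory (haarProbability)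
open scoped ENNReal

/-! ## §1 Kernel bookkeeping: powers of a site update that reads only its own site -/

section Bookkeeping

variable {α : Type*} [MeasurableSpace α]

/-- `nHit κ (a + b) = nHit κ a ∘ₖ nHit κ b`. -/
theorem nHit_add (κ : Kernel α α) (a b : ℕ) : nHit κ (a + b) = nHit κ a ∘ₖ nHit κ b := by
  induction a with
  | zero => rw [Nat.zero_add, nHit_zero, Kernel.id_comp]
  | succ a ih => rw [Nat.succ_add, nHit_succ, nHit_succ, ih, Kernel.comp_assoc]

/-- Powers of a Markov kernel are Markov (row 9's `DoeblinAutocovariance.isMarkovKernel_nHit`), as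
an instance. -/
instance instIsMarkovKernelNHit (κ : Kernel α α) [IsMarkovKernel κ] (n : ℕ) :
    IsMarkovKernel (nHit κ n) := isMarkovKernel_nHit κ n

variable {ι : Type*} [DecidableEq ι] {X : ι → Type*} [∀ i, MeasurableSpace (X i)]

/-- **`n` updates of site `l` by a kernel reading only site `l` are ONE update by its `n`-th power**:
`(siteLift l (κ ∘ eval l))^n = siteLift l (κ^n ∘ eval l)` (the environment is untouched and unread). -/
theorem nHit_siteLift_eval (l : ι) (κ : Kernel (X l) (X l)) [IsMarkovKernel κ] :
    ∀ n : ℕ, nHit (siteLift l (Kernel.comap κ (eval l) (measurable_pi_apply l))) n =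
      siteLift l (Kernel.comap (nHit κ n) (eval l) (measurable_pi_apply l))
  | 0 => by
      ext ω s hs
      rw [nHit_zero, nHit_zero, Kernel.id_apply, siteLift_apply, Kernel.comap_apply, Kernel.id_apply,
        Measure.map_dirac' (measurable_update ω), eval, update_eq_self]
  | n + 1 => by
      haveI := isMarkovKernel_nHit κ n
      rw [nHit_succ, nHit_siteLift_eval l κ n]
      ext ω s hs
      rw [Kernel.comp_apply' _ _ _ hs, siteLift_apply, Kernel.comap_apply,
        lintegral_map (Kernel.measurable_coe _ hs) (measurable_update ω), siteLift_apply,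
        Kernel.comap_apply, nHit_succ, Measure.map_apply (measurable_update ω) hs, eval,
        Kernel.comp_apply' _ _ _ (measurable_update ω hs)]
      refine lintegral_congr fun ξ => ?_
      rw [siteLift_apply, Kernel.comap_apply, Measure.map_apply (measurable_update _) hs, eval,
        update_self]
      congr 1
      ext ξ'
      simp only [mem_preimage, update_idem]

end Bookkeeping

/-! ## §2 One visit of a `U(1)` link: `2^j` kicks cover the circle, the hits accept often enough -/

section Visit

variable {ι : Type*} [DecidableEq ι]

/-- **Haar measure is invariant under a kick** `u ↦ V u`, `V ∼ ρ` (left invariance, Fubini). -/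
theorem haar_bind_mulWalk (ρ : Measure Circle) [IsProbabilityMeasure ρ] :
    (haarProbability Circle).bind ⇑(mulWalk ρ) = haarProbability Circle := by
  ext s hs
  rw [Measure.bind_apply hs (Kernel.aemeasurable _)]
  have h : ∀ u : Circle, mulWalk ρ u s = ∫⁻ V, s.indicator 1 (V * u) ∂ρ := fun u => by
    rw [← lintegral_indicator_one hs, lintegral_mulWalk _ u (measurable_one.indicator hs)]
  simp_rw [h]
  rw [lintegral_lintegral_swap (f := fun (a V : Circle) => s.indicator (1 : Circle → ℝ≥0∞) (V * a))
    (show Measurable (fun q : Circle × Circle => s.indicator (1 : Circle → ℝ≥0∞) (q.2 * q.1)) from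
      (measurable_one.indicator hs).comp (measurable_snd.mul measurable_fst)).aemeasurable]
  have hin : ∀ V : Circle, ∫⁻ u, s.indicator (1 : Circle → ℝ≥0∞) (V * u) ∂(haarProbability Circle) =
      haarProbability Circle s := fun V => by
    rw [show (fun u => s.indicator (1 : Circle → ℝ≥0∞) (V * u)) = fun u => ((V * ·) ⁻¹' s).indicator 1 u
      from rfl, lintegral_indicator_one (measurable_const_mul V hs), measure_preimage_mul]
  simp_rw [hin]
  rw [MeasureTheory.lintegral_const, measure_univ, mul_one]

/-- **`2^j` kicks of one link dominate `δ ·` Haar from every start once `(3/2)^j s ≥ π`**, with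
`δ = (2s)^{−2^j} · c_j(s) · 2π` explicit (`UniformKickDoubling`). -/
theorem u1Kick_nHit_minorised {s : ℝ} (hs : 0 < s) {j : ℕ} (hj : Real.pi ≤ doublingRadius s j)
    (u : Circle) :
    ((ENNReal.ofReal (2 * s))⁻¹ ^ 2 ^ j * (doublingConst s j * ENNReal.ofReal (2 * Real.pi))) •
        haarProbability Circle ≤ nHit (mulWalk (u1KickLaw s)) (2 ^ j) u := by
  have h2s : ENNReal.ofReal (2 * s) ≠ 0 := by
    rw [Ne, ENNReal.ofReal_eq_zero, not_le]; positivity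
  have hf : Measurable fun θ : ℝ => Circle.exp θ * u :=
    (Circle.exp.continuous.mul continuous_const).measurable
  have hmu : Measurable fun g : Circle => g * u := measurable_mul_const u
  have hcomp : (fun θ : ℝ => Circle.exp θ * u) = (fun g : Circle => g * u) ∘ Circle.exp := rfl
  -- the covering bound at level `j` (as in `exists_smul_haar_le_map_convDouble`, with `j` given)
  have hcov : (doublingConst s j * ENNReal.ofReal (2 * Real.pi)) • haarProbability Circle ≤
      (convDouble (volume.restrict (ball (0 : ℝ) s)) j).map (fun θ : ℝ => Circle.exp θ * u) := by
    calc (doublingConst s j * ENNReal.ofReal (2 * Real.pi)) • haarProbability Circle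
        = doublingConst s j • ((ENNReal.ofReal (2 * Real.pi) • haarProbability Circle).map
            (fun g : Circle => g * u)) := by
          rw [Measure.map_smul, map_mul_right_eq_self, smul_smul]
      _ = doublingConst s j • (volume.restrict (ball (0 : ℝ) Real.pi)).map (fun θ : ℝ => Circle.exp θ * u) := by
          rw [smul_haarProbability_circle_eq_map_exp, Measure.map_map hmu Circle.exp.continuous.measurable,
            ← hcomp]
      _ ≤ doublingConst s j • (volume.restrict (ball (0 : ℝ) (doublingRadius s j))).map
            (fun θ : ℝ => Circle.exp θ * u) :=
          measure_smul_le_smul_of_le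
            (Measure.map_mono (Measure.restrict_mono (ball_subset_ball hj) le_rfl) hf) _
      _ = (doublingConst s j • volume.restrict (ball (0 : ℝ) (doublingRadius s j))).map
            (fun θ : ℝ => Circle.exp θ * u) := (Measure.map_smul _ _ _).symm
      _ ≤ (convDouble (volume.restrict (ball (0 : ℝ) s)) j).map (fun θ : ℝ => Circle.exp θ * u) :=
          Measure.map_mono (smul_restrict_ball_le_convDouble s j) hf
  rw [u1KickLaw, nHit_mulWalk_map_exp, convPow_smul _ _ (ENNReal.inv_ne_top.2 h2s), convPow_two_pow,
    Measure.map_smul, mul_smul]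
  exact measure_smul_le_smul_of_le hcov _

/-- … and so do `n ≥ 2^j` kicks (the extra kicks preserve Haar measure). -/
theorem u1Kick_nHit_minorised_of_le {s : ℝ} (hs : 0 < s) {j n : ℕ} (hj : Real.pi ≤ doublingRadius s j)
    (hn : 2 ^ j ≤ n) (u : Circle) :
    ((ENNReal.ofReal (2 * s))⁻¹ ^ 2 ^ j * (doublingConst s j * ENNReal.ofReal (2 * Real.pi))) •
        haarProbability Circle ≤ nHit (mulWalk (u1KickLaw s)) n u := by
  haveI := isProbabilityMeasure_u1KickLaw hs
  obtain ⟨e, rfl⟩ := Nat.exists_eq_add_of_le hn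
  rw [add_comm, nHit_add]
  have h := minorised_comp_left (fun v => u1Kick_nHit_minorised hs hj v) (nHit (mulWalk (u1KickLaw s)) e) u
  have hinv : Kernel.Invariant (mulWalk (u1KickLaw s)) (haarProbability Circle) := haar_bind_mulWalk _
  rwa [(invariant_nHit hinv e).def] at h

variable (s : ℝ) (w : (ι → Circle) → ℝ) (l : ι)

/-- **The proposal of the sweep on the full configuration space**: kick link `l` by `e^{iθ}`,
`θ` uniform on `|θ| < s`, keep every other link. -/
def u1LinkProposal : Kernel (ι → Circle) (ι → Circle) :=
  siteLift l (Kernel.comap (mulWalk (u1KickLaw s)) (eval l) (measurable_pi_apply l))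

/-- The proposal kernel is s-finite. -/
instance isSFiniteKernel_u1LinkProposal : IsSFiniteKernel (u1LinkProposal s l : Kernel (ι → Circle) _) := by
  unfold u1LinkProposal siteLift; infer_instance

/-- **The Metropolis hit of link `l`** for the joint weight `w` (`= e^{−S}`): propose the kick,
accept with `min(1, w(U')/w(U))`. -/
def u1LinkHit : Kernel (ι → Circle) (ι → Circle) := symMH (u1LinkProposal s l) w

/-- **The engine's Metropolis sweep**: visit the links of `L` in order, `n` hits each. -/
def u1MetropolisSweep (n : ℕ) (L : List ι) : Kernel (ι → Circle) (ι → Circle) :=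
  cycle (L.map fun l => nHit (u1LinkHit s w l) n)

variable {s w l} {m M : ℝ}

/-- **One visit dominates a multiple of the free Haar refresh of the link, uniformly in the
configuration**: `n ≥ 2^j` hits, `(3/2)^j s ≥ π`, weight pinched `0 < m ≤ w ≤ M`. -/
theorem u1LinkVisit_minorised (hs : 0 < s) (hw : Measurable w) (hm : 0 < m) (hwm : ∀ U, m ≤ w U)
    (hwM : ∀ U, w U ≤ M) {j n : ℕ} (hj : Real.pi ≤ doublingRadius s j) (hn : 2 ^ j ≤ n)
    (U : ι → Circle) :
    (ENNReal.ofReal (m / M) ^ n *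
        ((ENNReal.ofReal (2 * s))⁻¹ ^ 2 ^ j * (doublingConst s j * ENNReal.ofReal (2 * Real.pi)))) •
      refresh (fun _ : ι => haarProbability Circle) l U ≤ nHit (u1LinkHit s w l) n U := by
  haveI := isProbabilityMeasure_u1KickLaw hs
  haveI := isMarkovKernel_nHit (mulWalk (u1KickLaw s)) n
  rw [mul_smul]
  refine le_trans (measure_smul_le_smul_of_le ?_ _)
    (by unfold u1LinkHit; exact smul_nHit_le_nHit_symMH hw hm hwm hwM n U)
  rw [u1LinkProposal, nHit_siteLift_eval, siteLift_apply, Kernel.comap_apply, refresh, siteLift_apply,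
    Kernel.const_apply, ← Measure.map_smul]
  exact Measure.map_mono (u1Kick_nHit_minorised_of_le hs hj hn (U l)) (measurable_update U)

end Visit

/-! ## §3 The sweep: Doeblin, uniform ergodicity, at most one invariant law -/

section Sweep

variable {ι : Type*} [DecidableEq ι] [Fintype ι] {s : ℝ} {w : (ι → Circle) → ℝ} {m M : ℝ}

/-- **DOEBLIN FOR THE `U(1)` METROPOLIS SWEEP.**  Kick size `s > 0`, measurable joint weight pinched
`0 < m ≤ w ≤ M`, `n ≥ 2^j` hits per visit with `(3/2)^j s ≥ π`, a scan `L` visiting every link: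
`K(U, ·) ≥ ε^{|L|} · Haar^{⊗ι}` from EVERY configuration `U`, `ε = (m/M)^n (2s)^{−2^j} c_j(s) 2π`. -/
theorem u1MetropolisSweep_minorised (hs : 0 < s) (hw : Measurable w) (hm : 0 < m) (hwm : ∀ U, m ≤ w U)
    (hwM : ∀ U, w U ≤ M) {j n : ℕ} (hj : Real.pi ≤ doublingRadius s j) (hn : 2 ^ j ≤ n)
    {L : List ι} (hL : ∀ l, l ∈ L) (U : ι → Circle) :
    (ENNReal.ofReal (m / M) ^ n *
        ((ENNReal.ofReal (2 * s))⁻¹ ^ 2 ^ j * (doublingConst s j * ENNReal.ofReal (2 * Real.pi)))) ^ L.length •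
      Measure.pi (fun _ : ι => haarProbability Circle) ≤ u1MetropolisSweep s w n L U := by
  have hcycle := cycle_refresh_eq_const (μ := fun _ : ι => haarProbability Circle) hL
  have hF : List.Forall₂ (fun κ Φ => ∀ a : ι → Circle,
      (ENNReal.ofReal (m / M) ^ n * ((ENNReal.ofReal (2 * s))⁻¹ ^ 2 ^ j *
        (doublingConst s j * ENNReal.ofReal (2 * Real.pi)))) • Φ a ≤ κ a)
      (L.map fun l => nHit (u1LinkHit s w l) n) (L.map (refresh fun _ : ι => haarProbability Circle)) := by
    rw [List.forall₂_map_left_iff, List.forall₂_map_right_iff, List.forall₂_same]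
    intro l _ a
    exact u1LinkVisit_minorised hs hw hm hwm hwM hj hn a
  have h := cycle_minorised hF U
  rw [List.length_map, hcycle, Kernel.const_apply] at h
  exact h

omit [Fintype ι] in
/-- The sweep is a Markov kernel (probability step law, measurable weight). -/
theorem isMarkovKernel_u1MetropolisSweep (hs : 0 < s) (hw : Measurable w) (n : ℕ) (L : List ι) :
    IsMarkovKernel (u1MetropolisSweep s w n L) := by
  haveI := isProbabilityMeasure_u1KickLaw hs
  haveI : Fact (Measurable w) := ⟨hw⟩
  refine isMarkovKernel_cycle fun κ hκ => ?_
  obtain ⟨l, -, rfl⟩ := List.mem_map.1 hκ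
  haveI : IsMarkovKernel (u1LinkProposal s l : Kernel (ι → Circle) _) := by
    unfold u1LinkProposal; infer_instance
  haveI : IsMarkovKernel (u1LinkHit s w l) := by unfold u1LinkHit; infer_instance
  exact isMarkovKernel_nHit _ n

/-- **UNIFORM ERGODICITY OF THE `U(1)` METROPOLIS SWEEP** towards any probability law it leaves
invariant (the Gibbs law `Z⁻¹e^{−S}Haar^{⊗ι}`, once its invariance on the product space is supplied):
`|μ₀Kᵗ(A) − π(A)| ≤ (1 − ε^{|L|})ᵗ` for every initial law, every `t`, every `A`. -/
theorem u1MetropolisSweep_uniformlyErgodic (hs : 0 < s) (hw : Measurable w) (hm : 0 < m)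
    (hwm : ∀ U, m ≤ w U) (hwM : ∀ U, w U ≤ M) {j n : ℕ} (hj : Real.pi ≤ doublingRadius s j)
    (hn : 2 ^ j ≤ n) {L : List ι} (hL : ∀ l, l ∈ L) {π : Measure (ι → Circle)} [IsProbabilityMeasure π]
    (hπ : Kernel.Invariant (u1MetropolisSweep s w n L) π) (μ₀ : Measure (ι → Circle))
    [IsProbabilityMeasure μ₀] (t : ℕ) (A : Set (ι → Circle)) :
    |((fun ν : Measure (ι → Circle) => ν.bind (u1MetropolisSweep s w n L))^[t] μ₀).real A - π.real A| ≤
      (1 - ((ENNReal.ofReal (m / M) ^ n * ((ENNReal.ofReal (2 * s))⁻¹ ^ 2 ^ j *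
        (doublingConst s j * ENNReal.ofReal (2 * Real.pi)))) ^ L.length).toReal) ^ t := by
  haveI := isMarkovKernel_u1MetropolisSweep hs hw n L
  exact uniformlyErgodic_of_minorised (u1MetropolisSweep_minorised hs hw hm hwm hwM hj hn hL) hπ μ₀ t A

/-- **The sweep has at most one invariant probability law** (Doeblin). -/
theorem u1MetropolisSweep_invariant_subsingleton (hs : 0 < s) (hw : Measurable w) (hm : 0 < m)
    (hwm : ∀ U, m ≤ w U) (hwM : ∀ U, w U ≤ M) {j n : ℕ} (hj : Real.pi ≤ doublingRadius s j)
    (hn : 2 ^ j ≤ n) {L : List ι} (hL : ∀ l, l ∈ L) {π π' : Measure (ι → Circle)}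
    [IsProbabilityMeasure π] [IsProbabilityMeasure π']
    (hπ : Kernel.Invariant (u1MetropolisSweep s w n L) π)
    (hπ' : Kernel.Invariant (u1MetropolisSweep s w n L) π') : π' = π := by
  haveI := isMarkovKernel_u1MetropolisSweep hs hw n L
  have hM : 0 < M := hm.trans_le ((hwm fun _ => 1).trans (hwM _))
  refine invariant_unique_of_minorised (u1MetropolisSweep_minorised hs hw hm hwm hwM hj hn hL)
    (pos_iff_ne_zero.2 (pow_ne_zero _ (mul_ne_zero (pow_ne_zero _ ?_) (mul_ne_zero
      (pow_ne_zero _ (ENNReal.inv_ne_zero.2 ENNReal.ofReal_ne_top))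
      (mul_ne_zero (doublingConst_ne_zero hs j) ?_))))) hπ hπ'
  · rw [Ne, ENNReal.ofReal_eq_zero, not_le]; exact div_pos hm hM
  · rw [Ne, ENNReal.ofReal_eq_zero, not_le]; positivity

end Sweep

end Summit.Ventures.LatticeQCDFlow.Exactness
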